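import Mathlib
import Summits.KontsevichZagierPeriods.KontsevichZagierPeriods.Theorems.SoloInformedDivisionChainE
import Summits.KontsevichZagierPeriods.KontsevichZagierPeriods.Theorems.SoloInformedKummerZeta
import Summits.KontsevichZagierPeriods.KontsevichZagierPeriods.Theorems.SoloInformedDecidedHulls
import Literature.NumberTheory.Transcendental.KZBallVolume
import HarnessLib
import HarnessLib.Audit

/-!
# Division by translation VII: THEOREM XXIX(i) KERNEL at all torsion orders (solo-informed, s43)

Seventh and last file of LEMMA XXIX.1 KERNEL.  Input: a division chain `(s_j)_{j ≤ q}` for the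
algebraic modulus `0 < m < 1` (part III), `0 < p < q`, `σ = s_p` (model: `σ = sn(pK/q | m)`).
Parts III and VI give, in the formal period ring `P`,

  `q·[F_σ] = p·[K]`,  `q·([E_σ] + [pt, ζ_p]) = p·([E] + [pt, ζ_q])`,

and Kummer's reciprocity (`soloInformed_kummer_reciprocity`, s41) reads
`[pt, c_σ]·([Π(mσ²)] − [K]) = [K][E_σ] − [E][F_σ]`, `c_σ = √((1−σ²)(1−mσ²))/σ`.  Eliminating
`[F_σ]`, `[E_σ]` (the products `[K][E]` cancel — Legendre's relation is NOT needed):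

  **`q·[pt, c_σ]·([Π(m s_p² | m)] − [K(m)]) = (p·[pt, ζ_q] − q·[pt, ζ_p])·[K(m)]`**

(`soloInformed_divChain_thirdKind`), i.e. `K·Z(pK/q) ≡ ((p ζ_q − q ζ_p)/q)·K`: Jacobi's zeta
function at a torsion point is the algebraic number `(p ζ_q − q ζ_p)/q`, as an identity of
classes.  Inverting the algebraic point class `q c_σ` (point classes form a ring, s12):

  **THEOREM XXIX(i) KERNEL.** `[Π(m s_p² | m)] = [pt, λ]·[K(m)]`,
  `λ = 1 + (p ζ_q − q ζ_p)/(q c_σ) ∈ ℚ̄ ∩ ℝ` (`soloInformed_divChain_thirdKind_pointClass`),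

so the complete integral of the third kind at every torsion characteristic of the chain is
equivalent under the Kontsevich–Zagier moves to an explicit algebraic multiple of `K(m)`; in
particular `Π(m s_p²|m) = λ·K(m)` numerically (`…_value`).  The bisection case `q = 2` is s42's
THEOREM XXIX(i); here `q` is arbitrary and the only input is the chain.

References: C. G. J. Jacobi, *Fundamenta nova* (1829), §§53–55; A. M. Legendre, *Traité* I
(1825), ch. XXIII; M. Kontsevich, D. Zagier, *Periods* (2001), §1.2, §4.1; this work
(solo-informed s41–s43).
-/

noncomputable section

open MeasureTheory Set Filter
open scoped Classical

open Literature.NumberTheory.Transcendental Literature.NumberTheory.Transcendental.KZ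
open Literature.ModelTheory.ExponentialFields

namespace Summit.KontsevichZagierPeriods.KontsevichZagierPeriods.Theorems

/-- An inner abscissa `s_p`, `0 < p < q`, of a division chain lies in `(0,1)`. [this work] -/
theorem soloInformed_divChain_mem_Ioo {m : ℝ} {q : ℕ} (c : SoloInformedDivChain m q)
    (hm : m ∈ Ioo (0:ℝ) 1) (hma : IsAlgebraic ℚ m) {p : ℕ} (hp0 : 0 < p) (hpq : p < q) :
    c.s p ∈ Ioo (0:ℝ) 1 := by
  refine ⟨?_, soloInformed_divChain_lt_one c hm hma hpq⟩
  induction p with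
  | zero => exact absurd hp0 (lt_irrefl 0)
  | succ p ih =>
    rcases Nat.eq_zero_or_pos p with rfl | hp
    · exact c.one_pos
    · exact (ih hp (Nat.lt_of_succ_lt hpq)).trans
        (soloInformed_divChain_lt_succ c hm hma (Nat.lt_of_succ_lt hpq))

/-- The Kummer scalar `c_σ = √((1−σ²)(1−mσ²))/σ` is positive for `σ ∈ (0,1)`. [folklore] -/
theorem soloInformed_kummerScalar_pos {m σ : ℝ} (hm : m ∈ Ioo (0:ℝ) 1) (hσ : σ ∈ Ioo (0:ℝ) 1) :
    0 < √((1 - σ ^ 2) * (1 - m * σ ^ 2)) / σ := by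
  have h1 : 0 < 1 - σ ^ 2 := by nlinarith [hσ.1, hσ.2]
  have h2 : 0 < 1 - m * σ ^ 2 := by nlinarith [hm.1, hm.2, hσ.1, hσ.2]
  exact div_pos (Real.sqrt_pos.2 (mul_pos h1 h2)) hσ.1

/-- **`q·[pt, c_σ]·([Π(m s_p²)] − [K]) = (p·[pt, ζ_q] − q·[pt, ζ_p])·[K]`** along a division
chain (`σ = s_p`, `0 < p < q`): Kummer's reciprocity with the two torsion identities
substituted; `K·Z(pK/q)` is the algebraic multiple `(p ζ_q − q ζ_p)/q` of `K`, as classes.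
[Jacobi 1829, §55; this work] -/
theorem soloInformed_divChain_thirdKind {m : ℝ} {q : ℕ} (c : SoloInformedDivChain m q)
    (hm : m ∈ Ioo (0:ℝ) 1) (hma : IsAlgebraic ℚ m) {p : ℕ} (hp0 : 0 < p) (hpq : p < q)
    (PN K E : IntegralRep 1) (hPNd : PN.domain = {x | x 0 ∈ Ioo (0:ℝ) 1})
    (hPNi : EqOn PN.integrand (fun x => (1 - m * c.s p ^ 2 * x 0 ^ 2)⁻¹ *
      ((√(1 - x 0 ^ 2))⁻¹ * (√(1 - m * x 0 ^ 2))⁻¹)) PN.domain)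
    (hKd : K.domain = {x | x 0 ∈ Ioo (0:ℝ) 1})
    (hKi : EqOn K.integrand (fun x => (√(1 - x 0 ^ 2))⁻¹ * (√(1 - m * x 0 ^ 2))⁻¹) K.domain)
    (hEd : E.domain = {x | x 0 ∈ Ioo (0:ℝ) 1})
    (hEi : EqOn E.integrand (fun x => (1 - m * x 0 ^ 2) *
      ((√(1 - x 0 ^ 2))⁻¹ * (√(1 - m * x 0 ^ 2))⁻¹)) E.domain)
    (hzq : IsAlgebraic ℚ (c.zeta q)) (hzp : IsAlgebraic ℚ (c.zeta p)) :
    (q : FormalPeriodRing) *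
        toFormalPeriod (of (IntegralRep.unit.constMul
          (√((1 - c.s p ^ 2) * (1 - m * c.s p ^ 2)) / c.s p)
          (soloInformed_kummerZeta_scalar_isAlgebraic hm hma
            (soloInformed_divChain_mem_Ioo c hm hma hp0 hpq)
            (soloInformed_divChain_mem c hm hma p hpq.le).2))) *
        (toFormalPeriod (of PN) - toFormalPeriod (of K)) =
      ((p : FormalPeriodRing) * toFormalPeriod (of (IntegralRep.unit.constMul (c.zeta q) hzq)) -
        (q : FormalPeriodRing) * toFormalPeriod (of (IntegralRep.unit.constMul (c.zeta p) hzp))) *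
        toFormalPeriod (of K) := by
  have hσ := soloInformed_divChain_mem_Ioo c hm hma hp0 hpq
  have hσa := (soloInformed_divChain_mem c hm hma p hpq.le).2
  obtain ⟨Fs, hFsd, hFsi⟩ := soloInformed_exists_divChain_rep c hm hma hpq.le
  obtain ⟨Es, hEsd, hEsi⟩ := soloInformed_exists_divChain_repE c hm hma hpq.le
  have R := soloInformed_kummer_reciprocity m (c.s p) hm hma hσ hσa PN K E Fs Es hPNd hPNi hKd
    hKi hEd hEi hFsd (fun x _ => hFsi x) hEsd (fun x _ => hEsi x)
  have hT1 := soloInformed_divChain_torsion c hm hma K Fs hpq.le hKd hKi hFsd fun x _ => hFsi x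
  have hT2 := soloInformed_divChain_torsionE c hm hma E Es hpq.le hEd hEi hEsd
    (fun x _ => hEsi x) hzq hzp
  linear_combination (q : FormalPeriodRing) * R + toFormalPeriod (of K) * hT2 -
    toFormalPeriod (of E) * hT1

/-- **THEOREM XXIX(i) KERNEL (all torsion orders).**  Along a division chain of order `q` for
the algebraic modulus `0 < m < 1` and for `0 < p < q`, the complete integral of the third kind
at the torsion characteristic `n = m s_p²` is an explicit ALGEBRAIC multiple of `K(m)` in `P`:
`[Π(m s_p² | m)] = [pt, λ]·[K(m)]`, `λ = 1 + (p ζ_q − q ζ_p)/(q c_σ)`,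
`c_σ = √((1−s_p²)(1−m s_p²))/s_p`. [this work] -/
theorem soloInformed_divChain_thirdKind_pointClass {m : ℝ} {q : ℕ} (c : SoloInformedDivChain m q)
    (hm : m ∈ Ioo (0:ℝ) 1) (hma : IsAlgebraic ℚ m) {p : ℕ} (hp0 : 0 < p) (hpq : p < q)
    (PN K : IntegralRep 1) (hPNd : PN.domain = {x | x 0 ∈ Ioo (0:ℝ) 1})
    (hPNi : EqOn PN.integrand (fun x => (1 - m * c.s p ^ 2 * x 0 ^ 2)⁻¹ *
      ((√(1 - x 0 ^ 2))⁻¹ * (√(1 - m * x 0 ^ 2))⁻¹)) PN.domain)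
    (hKd : K.domain = {x | x 0 ∈ Ioo (0:ℝ) 1})
    (hKi : EqOn K.integrand (fun x => (√(1 - x 0 ^ 2))⁻¹ * (√(1 - m * x 0 ^ 2))⁻¹) K.domain) :
    IsAlgebraic ℚ (1 + ((q : ℝ) * (√((1 - c.s p ^ 2) * (1 - m * c.s p ^ 2)) / c.s p))⁻¹ *
        ((p : ℝ) * c.zeta q - (q : ℝ) * c.zeta p)) ∧
      ∀ hl : IsAlgebraic ℚ (1 + ((q : ℝ) * (√((1 - c.s p ^ 2) * (1 - m * c.s p ^ 2)) / c.s p))⁻¹ *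
          ((p : ℝ) * c.zeta q - (q : ℝ) * c.zeta p)),
        toFormalPeriod (of PN) =
          toFormalPeriod (of (IntegralRep.unit.constMul _ hl)) * toFormalPeriod (of K) := by
  have hσ := soloInformed_divChain_mem_Ioo c hm hma hp0 hpq
  have hσa := (soloInformed_divChain_mem c hm hma p hpq.le).2
  have hcσ := soloInformed_kummerZeta_scalar_isAlgebraic hm hma hσ hσa
  have hzq := soloInformed_divChain_zeta_isAlgebraic c hm hma q le_rfl
  have hzp := soloInformed_divChain_zeta_isAlgebraic c hm hma p hpq.le
  set cσ := √((1 - c.s p ^ 2) * (1 - m * c.s p ^ 2)) / c.s p with hcσ'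
  have hq0 : 0 < q := lt_of_le_of_lt (Nat.zero_le p) hpq
  have hqa : IsAlgebraic ℚ (q : ℝ) := isAlgebraic_nat q
  have hpa : IsAlgebraic ℚ (p : ℝ) := isAlgebraic_nat p
  have hu : IsAlgebraic ℚ ((q : ℝ) * cσ) := hqa.mul hcσ
  have hu0 : (q : ℝ) * cσ ≠ 0 :=
    (mul_pos (Nat.cast_pos.2 hq0) (soloInformed_kummerScalar_pos hm hσ)).ne'
  have hui : IsAlgebraic ℚ ((q : ℝ) * cσ)⁻¹ := hu.inv
  have hz : IsAlgebraic ℚ ((p : ℝ) * c.zeta q - (q : ℝ) * c.zeta p) :=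
    (hpa.mul hzq).sub (hqa.mul hzp)
  have hw : IsAlgebraic ℚ (((q : ℝ) * cσ)⁻¹ * ((p : ℝ) * c.zeta q - (q : ℝ) * c.zeta p)) :=
    hui.mul hz
  have hl : IsAlgebraic ℚ (1 + ((q : ℝ) * cσ)⁻¹ * ((p : ℝ) * c.zeta q - (q : ℝ) * c.zeta p)) :=
    isAlgebraic_one.add hw
  refine ⟨hl, fun hl' => ?_⟩
  obtain ⟨E, hEd, hEi⟩ := soloInformed_exists_ellipticE_rep m hm hma
  have A := soloInformed_divChain_thirdKind c hm hma hp0 hpq PN K E hPNd hPNi hKd hKi hEd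
    (fun x _ => hEi x) hzq hzp
  -- point-class arithmetic
  have P1 : (q : FormalPeriodRing) * toFormalPeriod (of (IntegralRep.unit.constMul cσ hcσ)) =
      toFormalPeriod (of (IntegralRep.unit.constMul ((q : ℝ) * cσ) hu)) := by
    rw [← toFormalPeriod_of_unit_constMul_natCast q hqa, soloInformed_pointRep_mul]
  have hpz : IsAlgebraic ℚ ((p : ℝ) * c.zeta q) := hpa.mul hzq
  have hqz : IsAlgebraic ℚ ((q : ℝ) * c.zeta p) := hqa.mul hzp
  have hsum : IsAlgebraic ℚ ((p : ℝ) * c.zeta q - (q : ℝ) * c.zeta p + (q : ℝ) * c.zeta p) :=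
    hz.add hqz
  have P2 : (p : FormalPeriodRing) * toFormalPeriod (of (IntegralRep.unit.constMul (c.zeta q) hzq)) -
      (q : FormalPeriodRing) * toFormalPeriod (of (IntegralRep.unit.constMul (c.zeta p) hzp)) =
      toFormalPeriod (of (IntegralRep.unit.constMul _ hz)) := by
    rw [← toFormalPeriod_of_unit_constMul_natCast p hpa, ← toFormalPeriod_of_unit_constMul_natCast
      q hqa, soloInformed_pointRep_mul _ _ hpa hzq hpz, soloInformed_pointRep_mul _ _ hqa hzp hqz]
    have h := soloInformed_pointRep_add _ _ hz hqz hsum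
    rw [soloInformed_pointRep_congr hsum hpz (by ring)] at h
    linear_combination -h
  have P3 := soloInformed_pointRep_inv_mul ((q : ℝ) * cσ) hu hu0 hui
  have P4 := soloInformed_pointRep_mul _ _ hui hz hw
  have P5 := soloInformed_pointRep_add _ _ isAlgebraic_one hw hl'
  have P6 := soloInformed_pointRep_one (isAlgebraic_one (R := ℚ) (A := ℝ))
  rw [P1, P2] at A
  linear_combination toFormalPeriod (of K) * P5 - toFormalPeriod (of K) * P6 +
    toFormalPeriod (of K) * P4 + toFormalPeriod (of (IntegralRep.unit.constMul _ hui)) * A -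
    (toFormalPeriod (of PN) - toFormalPeriod (of K)) * P3

/-- **THEOREM XXIX(i), numerically:** `Π(m s_p² | m) = λ·K(m)` with the algebraic
`λ = 1 + (p ζ_q − q ζ_p)/(q c_σ)`. [this work] -/
theorem soloInformed_divChain_thirdKind_value {m : ℝ} {q : ℕ} (c : SoloInformedDivChain m q)
    (hm : m ∈ Ioo (0:ℝ) 1) (hma : IsAlgebraic ℚ m) {p : ℕ} (hp0 : 0 < p) (hpq : p < q)
    (PN K : IntegralRep 1) (hPNd : PN.domain = {x | x 0 ∈ Ioo (0:ℝ) 1})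
    (hPNi : EqOn PN.integrand (fun x => (1 - m * c.s p ^ 2 * x 0 ^ 2)⁻¹ *
      ((√(1 - x 0 ^ 2))⁻¹ * (√(1 - m * x 0 ^ 2))⁻¹)) PN.domain)
    (hKd : K.domain = {x | x 0 ∈ Ioo (0:ℝ) 1})
    (hKi : EqOn K.integrand (fun x => (√(1 - x 0 ^ 2))⁻¹ * (√(1 - m * x 0 ^ 2))⁻¹) K.domain) :
    PN.value = (1 + ((q : ℝ) * (√((1 - c.s p ^ 2) * (1 - m * c.s p ^ 2)) / c.s p))⁻¹ *
        ((p : ℝ) * c.zeta q - (q : ℝ) * c.zeta p)) * K.value := by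
  obtain ⟨hl, h⟩ := soloInformed_divChain_thirdKind_pointClass c hm hma hp0 hpq PN K hPNd hPNi
    hKd hKi
  have e := congrArg evalP (h hl)
  simpa only [map_mul, evalP_toFormalPeriod_of, IntegralRep.value_constMul,
    IntegralRep.value_unit, mul_one] using e

end Summit.KontsevichZagierPeriods.KontsevichZagierPeriods.Theorems

end
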